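import Summits.CriticalPhenomena.Ising3DConformalLimit.Theses.InverseSquareTelemetry
import Summits.CriticalPhenomena.Ising3DConformalLimit.Theorems.InverseSquareTelemetryEtaBoundsFromTelemetryBarriers
import Summits.CriticalPhenomena.Ising3DConformalLimit.Theorems.InverseSquareTelemetryInverseSquareLawUnitarityFromInfraredBound

/-!
# Crux `InverseSquareTelemetry.InverseSquareLaw` (stmt-CriticalPhenomena-4495) — birth skeleton `Lines/birth.lean`

Skeleton-registrar seat `planner-skel-stmt-CriticalPhenomena-4495-0`, 2026-08-17 (route re-audit bin
REPAIRABLE, BC3 of `run/shared/lean/lens3/_common/BC.md`). Route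
`route-CriticalPhenomena-InverseSquareTelemetry`, sub-problem `Ising3DConformalLimit`. Line card:
`Lines/birth.md`.

Write `G := criticalTwoPoint 3` (`⟨σ₀σ_x⟩⁺_{β_c}` on `ℤ³`), `s(x) := ∑ᵢ xᵢ²`, `|x|₂ := √s(x)`,
`(Δ_{ℤ³}G)(x) := Σᵢ (G(x+eᵢ) + G(x−eᵢ)) − 6 G(x)`, `V_eff := Δ_{ℤ³}G / G` and the TELEMETRY
`T(x) := s(x) · V_eff(x)` — the crux's left-hand side, kept verbatim in every statement below (closed
terms over Literature declarations; the three named `def`s only NAME the statements).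

The crux (T) `InverseSquareLaw` = `∃ κ ≥ 0, ε > 0, C, ∀ x ≠ 0, |T(x) − κ| ≤ C |x|₂^{−ε}` is cut along
its three mathematically distinct contents; each statement is a CONSEQUENCE of the crux (by uniqueness of
cofinite limits) and the three together give it back — `InverseSquareLaw ⟺ S1 ∧ S2 ∧ S3`, no piece
stronger than needed, none cheaply equivalent to the crux or the summit (BC3 probes, see the card):

* S1 `TelemetricLimit` / `stub_telemetricLimit` — the RATE-FREE inverse-square law (the idea card's T1):
  the telemetry has a limit `κ` along the cofinite filter of `ℤ³`. Existence AND isotropy of the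
  telemetric constant (the cofinite filter sees axes and diagonals alike); conjecturally
  `κ = η(1+η) ≈ 0.0376`. The physics core: no log-periodic modulation of `G`, no cubic anisotropy
  surviving in `|x|²ΔG/G`. [open; DuminilCopinICM2022 §8.1, §8.4; KosPolandSimmonsDuffinVichi2016]
* S2 `TelemetricUnitarity` / `stub_unitarityFromInfraredBound` — SIGN: a constant `κ` that the
  telemetry approaches at SOME power rate off a finite set (the output of S3) is `≥ 0`. Stated with the
  eventual Dini bound as hypothesis (weaker than a bare limit, so easier to prove, and exactly what the
  composition has in hand after S3). Provable in principle from tree theorems: `G > 0`, `G → 0`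
  (`criticalTwoPoint_tendsto_zero_cofinite`), the infrared bound `G ≤ C‖x‖⁻¹`
  (`criticalTwoPoint_bounds_holds`) and a sub-solution barrier comparison for `Δ − V_eff` on exterior
  sets (the engine of `Theorems/InverseSquareTelemetryEtaBoundsFromTelemetry*.lean`): for
  `−1/4 < κ < 0` the decaying indicial root `α₊(κ) = (1+√(1+4κ))/2 < 1` forces `G ≥ m |x|₂^{−α₊}`,
  contradicting the infrared bound; `κ ≤ −1/4` admits no positive solution tending to `0` compatible
  with `G ≤ C‖x‖⁻¹` (optimal lattice Hardy weight `(d−2)²/4 · |x|⁻²`, KellerPinchoverPogorzelski2018).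
  In CFT language `κ = 2Δ(2Δ−1) ≥ 0 ⟺` the unitarity bound `Δ ≥ 1/2`. [L-sized; not bookkeeping]
* S3 `TelemetricDiniRate` / `stub_diniRate` — RATE: IF the telemetry tends to `κ`, then it does so at
  a power (Dini) rate `|T(x) − κ| ≤ C |x|₂^{−ε}` for all but finitely many `x` (corrections-to-scaling
  gap `ω > 0`; conjecturally `ε = min(ω, ω₄) ≈ 0.83`). Conditional on the limit, hence NOT the crux
  reworded: without S1 it is vacuous; it isolates the irrelevant-operator gap from existence/isotropy.
  [open; KosPolandSimmonsDuffinVichi2016 (ω = Δ_{ε'} − 3)]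

**Status (lead c2, 2026-08-17).** S2 is LANDED (`Theorems.stub_unitarityFromInfraredBound`, p146352,
file `Theorems/InverseSquareTelemetryInverseSquareLawUnitarityFromInfraredBound.lean`, imported above) and
is now discharged INSIDE the composition, which reads `InverseSquareLaw_of : S1 → S3 → InverseSquareLaw`;
the registered stubs are S1 and S3 only (both the item's open-problem content). Rate-free consequences
of S1 proved by the lead (window `0 ≤ κ ≤ 2`; soft bounds `c_δ s^{-(α₊/2+δ)} ≤ G ≤ C_δ s^{-(α₊/2-δ)}`;
S1 ⇒ `HasIsingExponentEta 3 ((√(1+4κ)-1)/2)`, i.e. S1 alone gives item 0635) ride as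
`Theorems/InverseSquareTelemetryInverseSquareLawTelemetric{Window,SoftBounds,LimitEta}.lean`.

Composition `InverseSquareLaw_of : S1 → S3 → InverseSquareLaw` (originally `S1 → S2 → S3 → …`;
hypotheses = the registered stubs
BY NAME, via the implementation-detail aliases `__Registered.stub_…`, device of
`Cruxes/LoopsToCrossings/Lines/br-sandwich-diagonal.lean`) is kernel-checked below with NO sorry: S1
gives `κ`, S3 (fed with S1) the eventual Dini bound, the landed S2 (fed with S3) the sign, and the near-field patch
`forall_ne_zero_of_eventually_cofinite` (proved here: the exceptional set is finite and
`|x|₂^{−ε} > 0` off the origin, so enlarging `C` covers it) upgrades "all but finitely many `x`" to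
"every `x ≠ 0`", which is how the crux is typed. `InverseSquareLaw_of_stubs` applies it to the three
`stub_…` literally, which checks that statements, aliases and stubs agree.

Disproof used: none — `Cruxes/InverseSquareLaw/` had no `Disproof.lean` and the item no evidence at
registration time (`ledger crux ls stmt-CriticalPhenomena-4495`: no workfiles); `ledger negatives`
for the summit touches no telemetry statement (route header: only a SAW statement is refuted).
-/

namespace Summit.CriticalPhenomena.Ising3DConformalLimit.Cruxes.InverseSquareLaw.Birth

open Filter Topology Literature.Probability.LatticeModels
open Summit.CriticalPhenomena.Ising3DConformalLimit.Theses.InverseSquareTelemetry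
open Summit.CriticalPhenomena.Ising3DConformalLimit.Theorems

/-! ## The three statements, named (plain `def`s — no gate-reserved attributes in a workfile) -/

/-- **S1 (rate-free inverse-square law, T1).** The telemetry `T(x) = |x|₂² · (Δ_{ℤ³}G)(x)/G(x)` of the
critical two-point function of the `ℤ³` Ising model has a limit `κ` along the cofinite filter
(existence and isotropy of the telemetric constant; conjecturally `κ = η(1+η)`). -/
def TelemetricLimit : Prop :=
  ∃ κ : ℝ, Filter.Tendsto (fun x : Literature.Probability.LatticeModels.Site 3 => (∑ i, ((x i : ℝ)) ^ 2) * (((∑ i : Fin 3, (Literature.Probability.LatticeModels.criticalTwoPoint 3 (x + Pi.single i 1) + Literature.Probability.LatticeModels.criticalTwoPoint 3 (x - Pi.single i 1))) - 6 * Literature.Probability.LatticeModels.criticalTwoPoint 3 x) / Literature.Probability.LatticeModels.criticalTwoPoint 3 x)) Filter.cofinite (nhds κ)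

/-- **S2 (unitarity from the infrared bound).** A constant `κ` approached by the telemetry at some
power rate off a finite set is nonnegative. -/
def TelemetricUnitarity : Prop :=
  ∀ κ ε C : ℝ, 0 < ε → (∀ᶠ x : Literature.Probability.LatticeModels.Site 3 in Filter.cofinite, |(∑ i, ((x i : ℝ)) ^ 2) * (((∑ i : Fin 3, (Literature.Probability.LatticeModels.criticalTwoPoint 3 (x + Pi.single i 1) + Literature.Probability.LatticeModels.criticalTwoPoint 3 (x - Pi.single i 1))) - 6 * Literature.Probability.LatticeModels.criticalTwoPoint 3 x) / Literature.Probability.LatticeModels.criticalTwoPoint 3 x) - κ| ≤ C * Real.sqrt (∑ i, ((x i : ℝ)) ^ 2) ^ (-ε)) → 0 ≤ κ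

/-- **S3 (Dini rate, conditional on the limit).** If the telemetry tends to `κ` cofinitely, then it
does so at a power rate off a finite set. -/
def TelemetricDiniRate : Prop :=
  ∀ κ : ℝ, Filter.Tendsto (fun x : Literature.Probability.LatticeModels.Site 3 => (∑ i, ((x i : ℝ)) ^ 2) * (((∑ i : Fin 3, (Literature.Probability.LatticeModels.criticalTwoPoint 3 (x + Pi.single i 1) + Literature.Probability.LatticeModels.criticalTwoPoint 3 (x - Pi.single i 1))) - 6 * Literature.Probability.LatticeModels.criticalTwoPoint 3 x) / Literature.Probability.LatticeModels.criticalTwoPoint 3 x)) Filter.cofinite (nhds κ) → ∃ ε C : ℝ, 0 < ε ∧ ∀ᶠ x : Literature.Probability.LatticeModels.Site 3 in Filter.cofinite, |(∑ i, ((x i : ℝ)) ^ 2) * (((∑ i : Fin 3, (Literature.Probability.LatticeModels.criticalTwoPoint 3 (x + Pi.single i 1) + Literature.Probability.LatticeModels.criticalTwoPoint 3 (x - Pi.single i 1))) - 6 * Literature.Probability.LatticeModels.criticalTwoPoint 3 x) / Literature.Probability.LatticeModels.criticalTwoPoint 3 x) - κ| ≤ C * Real.sqrt (∑ i, ((x i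 : ℝ)) ^ 2) ^ (-ε)

/-! ## The registered stubs (the only `sorry`s of the file), statements verbatim -/

/-- **S1 (rate-free inverse-square law, T1)** — statement `TelemetricLimit` verbatim: the telemetry
`|x|₂² · (Δ_{ℤ³}G)/G` has ONE limit `κ` along the cofinite filter of `ℤ³` (existence + isotropy;
conjecturally `κ = η(1+η) ≈ 0.0376`). Hardest stub: the rate-free core of item 0634. -/
theorem stub_telemetricLimit :
    ∃ κ : ℝ, Filter.Tendsto (fun x : Literature.Probability.LatticeModels.Site 3 => (∑ i, ((x i : ℝ)) ^ 2) * (((∑ i : Fin 3, (Literature.Probability.LatticeModels.criticalTwoPoint 3 (x + Pi.single i 1) + Literature.Probability.LatticeModels.criticalTwoPoint 3 (x - Pi.single i 1))) - 6 * Literature.Probability.LatticeModels.criticalTwoPoint 3 x) / Literature.Probability.LatticeModels.criticalTwoPoint 3 x)) Filter.cofinite (nhds κ) := by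
  sorry

/-- **S2 (unitarity from the infrared bound)** — statement `TelemetricUnitarity` verbatim: if
`| |x|₂²V_eff(x) − κ | ≤ C|x|₂^{−ε}` off a finite set, then `0 ≤ κ`. A negative `κ` would make `G` a
positive, vanishing solution of `Δu = Vu` with `|x|²V → κ < 0` at a Dini rate, whose decay
`≳ |x|₂^{−α₊(κ)}`, `α₊(κ) = (1+√(1+4κ))/2 < 1` (sub-solution barrier `|x|₂^{−α₊}(1 + A|x|₂^{−e'})` +
the `h = |x|₂^{−1/2}`-transform maximum principle on exterior sets, valid for `κ > −1/4`), contradicts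
the infrared bound `G ≤ C‖x‖⁻¹` (`criticalTwoPoint_bounds_holds`); `κ < −1/4` admits no positive
supersolution near infinity (optimal lattice Hardy weight `1/(4|x|²)` on `ℤ³`,
KellerPinchoverPogorzelski2018, via Agmon–Allegretto–Piepenbrink on graphs); the double-root case
`κ = −1/4` needs the logarithmic barrier `|x|₂^{−1/2} log|x|₂`. Provable now (L): the engine of
`Theorems/InverseSquareTelemetryEtaBoundsFromTelemetry*.lean` (there with `κ ≥ 0`).
**LANDED** (lead c2, p146352, `Theorems/InverseSquareTelemetryInverseSquareLawUnitarityFromInfraredBound.lean`):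
for every `κ < 0` at once — `V_eff ≤ −k/s` eventually (`k = min(−κ/2, 1/8)`), so `G` is a supersolution
of `Δ − Ṽ`, `Ṽ = −k/s`; weight `s^{−1/4}`, subsolution `s^{−q}` (`q = 1/2 − k/4`),
`sub_le_super_of_hTransform` ⇒ `G ≥ m s^{−q}` far out, contradicting `G ≤ C‖x‖⁻¹`; no Hardy sub-case. -/
theorem stub_unitarityFromInfraredBound :
    ∀ κ ε C : ℝ, 0 < ε → (∀ᶠ x : Literature.Probability.LatticeModels.Site 3 in Filter.cofinite, |(∑ i, ((x i : ℝ)) ^ 2) * (((∑ i : Fin 3, (Literature.Probability.LatticeModels.criticalTwoPoint 3 (x + Pi.single i 1) + Literature.Probability.LatticeModels.criticalTwoPoint 3 (x - Pi.single i 1))) - 6 * Literature.Probability.LatticeModels.criticalTwoPoint 3 x) / Literature.Probability.LatticeModels.criticalTwoPoint 3 x) - κ| ≤ C * Real.sqrt (∑ i, ((x i : ℝ)) ^ 2) ^ (-ε)) → 0 ≤ κ :=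
  Summit.CriticalPhenomena.Ising3DConformalLimit.Theorems.stub_unitarityFromInfraredBound

/-- **S3 (Dini rate, conditional on the limit)** — statement `TelemetricDiniRate` verbatim: if the
telemetry tends to `κ`, there are `ε > 0` and `C` with `|T(x) − κ| ≤ C |x|₂^{−ε}` for all but
finitely many `x` (corrections-to-scaling gap; conjecturally `ε ≈ 0.83`). -/
theorem stub_diniRate :
    ∀ κ : ℝ, Filter.Tendsto (fun x : Literature.Probability.LatticeModels.Site 3 => (∑ i, ((x i : ℝ)) ^ 2) * (((∑ i : Fin 3, (Literature.Probability.LatticeModels.criticalTwoPoint 3 (x + Pi.single i 1) + Literature.Probability.LatticeModels.criticalTwoPoint 3 (x - Pi.single i 1))) - 6 * Literature.Probability.LatticeModels.criticalTwoPoint 3 x) / Literature.Probability.LatticeModels.criticalTwoPoint 3 x)) Filter.cofinite (nhds κ) → ∃ ε C : ℝ, 0 < ε ∧ ∀ᶠ x : Literature.Probability.LatticeModels.Site 3 in Filter.cofinite, |(∑ i, ((x i : ℝ)) ^ 2) * (((∑ i : Fin 3, (Literature.Probability.LatticeModels.criticalTwoPoint 3 (x + Pi.single i 1) + Literature.Probability.LatticeModels.criticalTwoPoint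 3 (x - Pi.single i 1))) - 6 * Literature.Probability.LatticeModels.criticalTwoPoint 3 x) / Literature.Probability.LatticeModels.criticalTwoPoint 3 x) - κ| ≤ C * Real.sqrt (∑ i, ((x i : ℝ)) ^ 2) ^ (-ε) := by
  sorry

/-! ## Aliases keyed by the registered stub names

`__Registered.stub_X` is the statement of `stub_X` under the stub's short name, so that the native
skeleton audit (`#h21_check_skeleton`: hypotheses admissible iff registered obligations / declared
stubs BY NAME) accepts `InverseSquareLaw_of : __Registered.stub_… → … → InverseSquareLaw`; the
namespace is an implementation detail, so the audit's stub report resolves each `stub_…` to the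
sorried theorem (full signature), not to its alias. -/
namespace __Registered

/-- Alias of `TelemetricLimit` keyed by the registered stub name. -/
abbrev stub_telemetricLimit : Prop := TelemetricLimit
/-- Alias of `TelemetricDiniRate` keyed by the registered stub name. -/
abbrev stub_diniRate : Prop := TelemetricDiniRate

end __Registered

/-! ## Glue proved here (no sorry) -/

/-- **Near-field patch.** On `ℤ³` an eventual (cofinite) bound `|T x − κ| ≤ C |x|₂^{−ε}` upgrades to
the same bound at every `x ≠ 0` with a larger constant: the exceptional set is finite
(`Filter.eventually_cofinite`) and `|x|₂^{−ε} > 0` off the origin (`1 ≤ ∑ᵢ xᵢ²`), so a ratio bound on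
the finite set (`EtaBoundsFromTelemetry.exists_le_mul_on_finite`) and `C' := max C M` do it.
[folklore] -/
theorem forall_ne_zero_of_eventually_cofinite (T : Site 3 → ℝ) (κ ε C : ℝ)
    (h : ∀ᶠ x : Site 3 in cofinite, |T x - κ| ≤ C * Real.sqrt (∑ i, ((x i : ℝ)) ^ 2) ^ (-ε)) :
    ∃ C' : ℝ, ∀ x : Site 3, x ≠ 0 → |T x - κ| ≤ C' * Real.sqrt (∑ i, ((x i : ℝ)) ^ 2) ^ (-ε) := by
  obtain ⟨M, _hM0, hM⟩ := EtaBoundsFromTelemetry.exists_le_mul_on_finite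
    (Filter.eventually_cofinite.1 h) (fun x => |T x - κ|)
    (fun x => Real.sqrt (∑ i, ((x i : ℝ)) ^ 2) ^ (-ε))
  refine ⟨max C M, fun x hx => ?_⟩
  have hs : 0 < Real.sqrt (∑ i, ((x i : ℝ)) ^ 2) :=
    Real.sqrt_pos.2 (lt_of_lt_of_le one_pos (PerfectScreening.one_le_sum_sq hx))
  have hg : 0 < Real.sqrt (∑ i, ((x i : ℝ)) ^ 2) ^ (-ε) := Real.rpow_pos_of_pos hs _
  by_cases hxF : |T x - κ| ≤ C * Real.sqrt (∑ i, ((x i : ℝ)) ^ 2) ^ (-ε)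
  · exact hxF.trans (mul_le_mul_of_nonneg_right (le_max_left C M) hg.le)
  · exact (hM x hxF hg).trans (mul_le_mul_of_nonneg_right (le_max_right C M) hg.le)

/-! ## Composition: the stubs conclude the crux BY NAME -/

/-- **The skeleton theorem (kernel-checked, sorry-free).** `S1 → S3 → InverseSquareLaw` (S2 landed and
used inside), the hypotheses being the OPEN registered stubs by name and the conclusion the route decl
`Theses.InverseSquareTelemetry.InverseSquareLaw`: `κ` from S1, `ε, C` and the eventual Dini bound
from S3 (fed with S1's limit), `0 ≤ κ` from the landed S2 (fed with S3's bound), and the near-field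
patch for the finitely many remaining `x ≠ 0`. -/
theorem InverseSquareLaw_of (h1 : __Registered.stub_telemetricLimit) (h3 : __Registered.stub_diniRate) :
    InverseSquareLaw := by
  unfold __Registered.stub_telemetricLimit TelemetricLimit at h1
  unfold __Registered.stub_diniRate TelemetricDiniRate at h3
  -- S2 is LANDED (p146352): the sign is discharged inside the proof, no longer a hypothesis
  have h2 : TelemetricUnitarity := stub_unitarityFromInfraredBound
  unfold TelemetricUnitarity at h2
  obtain ⟨κ, hκ⟩ := h1
  obtain ⟨ε, C, hε, hev⟩ := h3 κ hκ
  obtain ⟨C', hC'⟩ := forall_ne_zero_of_eventually_cofinite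
    (fun x : Site 3 => (∑ i, ((x i : ℝ)) ^ 2) * (((∑ i : Fin 3, (criticalTwoPoint 3 (x + Pi.single i 1) + criticalTwoPoint 3 (x - Pi.single i 1))) - 6 * criticalTwoPoint 3 x) / criticalTwoPoint 3 x)) κ ε C hev
  unfold InverseSquareLaw
  exact ⟨κ, ε, C', h2 κ ε C hε hev, hε, fun x hx => hC' x hx⟩

/-- The crux from the registered stubs, applied literally (checks that statements, aliases and stubs
agree; sorry-free once every `stub_…` is replaced by its landed proof; its type is the route decl). -/
theorem InverseSquareLaw_of_stubs : InverseSquareLaw :=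
  InverseSquareLaw_of stub_telemetricLimit stub_diniRate

end Summit.CriticalPhenomena.Ising3DConformalLimit.Cruxes.InverseSquareLaw.Birth
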